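import Summits.QuantumFields.BalabanUV.T4Continuum.Support.DirichletScalarTowerBox
import Summits.QuantumFields.BalabanUV.Beta.GAN24.DirichletBoxPairingBound
import Summits.QuantumFields.BalabanUV.Beta.GAN24.DirichletBoxRegularity

/-!
# `BalabanUV.T4Continuum.Support.DirichletBlockRegDefect` — NE2 (node U1a) formalisation swarm, sub-row `T4-U1a.S-NE2-D1-DIRICHLET°`, supplier item
# «Δ1-SKELETON» (file 19): FROM A SECOND-DIFFERENCE BUDGET TO THE TWO-LEVEL DEFECT — for the `U = 1` scalar region Dirichlet problem on a union
# of unit blocks `blockReg S`, a budget `‖∂_μᴴ∂_μ v‖² ≤ B·‖w‖²` for the fine-level solution `v = solExt (L·N) (blockReg S) w` (every axis, every datum)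
# gives the two-level injected law `‖(D′)⁻¹J − J D⁻¹‖ ≤ 2d·√γ′⁻¹·√B / N` — gan24-p2's pairing form of the defect + the pairing bound, with the
# region re-spelled from `refineR N L (blockReg_N S)` to `blockReg_{LN} S` (unit b2b-balaban-t4-ne2-formalise-leaf-08, gen 7, file 19)

HONEST FRAMING.  Rung (B)+1 bookkeeping at MODEL level (U = 1 scalar `Δ′ = Δ + a′Π′`, finite torus); [folklore]; NE2 (U1a) is NOT proved by
this file; spine PROVED 0/9 unchanged; NOT infinite volume, NOT the mass gap, NOT Clay.  HONEST DEPENDENCY (verbatim): «continuum YM on T⁴ ⇐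
BetaPertH ∧ nine spine estimates (0/9 proved); BetaPertH ⇐ (D1) ∧ (D4) ∧ CAP+tail; G-an2-4 gates asym, D1 and NE2/3/4.»

WHAT THIS FILE PROVES (0 sorry; gan24-p2 `form_defect` ∕ `norm_pairing_le` ∕ `opNorm_le_of_pairing` ∕ `nsq_sdiff_solExt_le` BY NAME).
`solExt_congr` (the region Dirichlet solution does not see the spelling of the region), `nsq_Pdir_eq`, and the END
**`opNorm_defect_blockReg_le_of_budget`**.

ABSOLUTE RULE (cell, verbatim): «No internally-minted statement may enter as a cited fact. Every hypothesis is either kernel-proved in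
this package or a verbatim quotation of a PUBLISHED theorem with page reference. The manuscript(s) under audit are NOT citable for
their own disputed steps — they are the thing under adjudication; programme-internal (2001/route/tribunal) claims are never citable.»
[folklore]; no definition; no `def … : Prop` fact; the budget is an explicit numeric HYPOTHESIS `hbud` (discharged for `d = 3` by file 18's
`nsq_sdiffH_sdiff_solExt_le_budget`, next file).  NOT CLAIMED: NE2, NE3.
-/

noncomputable section

open scoped BigOperators ComplexConjugate Matrix Matrix.Norms.L2Operator
open Finset

namespace Summit.QuantumFields.BalabanUV.T4Continuum.DirichletBlockRegDefect

open Literature.MathematicalPhysics.QuantumFieldTheory.Balaban1983to89.B5Prop11Plancherel (Tor fine)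
open Literature.MathematicalPhysics.QuantumFieldTheory.Balaban1983to89.B5Prop11Lower (nsq nsq_nonneg)
open Literature.MathematicalPhysics.QuantumFieldTheory.Balaban1983to89.B5Action121 (sdiff LapS)
open Summit.QuantumFields.BalabanUV.T4Continuum.ScalarAveragedPropagator (gammaPs gammaPs_pos)
open Summit.QuantumFields.BalabanUV.T4Continuum.DirichletScalarTowerBox (eqv toBlock_eq_submatrix nsq_comp_equiv)
open Summit.QuantumFields.BalabanUV.Beta.GAN24.DirichletBoxCompression
  (DOm JOm refineR solExt form_defect opNorm_le_of_pairing nsq_sdiff_solExt_le)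
open Summit.QuantumFields.BalabanUV.Beta.GAN24.DirichletBoxTrace (blockReg)
open Summit.QuantumFields.BalabanUV.Beta.GAN24.DirichletBoxTwoLevelCore (refineR_blockReg_iff)
open Summit.QuantumFields.BalabanUV.Beta.GAN24.DirichletBoxPairing (norm_pairing_le)
open Summit.QuantumFields.BalabanUV.Beta.GAN24.DirichletBoxRegularity (Pdir)

variable {d : ℕ} (n : ℕ) [NeZero n] (M : Fin d → ℕ) [hM : ∀ μ, NeZero (M μ)] (a' : ℝ)

/-- **the region Dirichlet solution does not see the spelling of the region**: for pointwise-equivalent predicates `p`, `q`,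
`solExt q w = solExt p (w ∘ (eqv h)⁻¹)`. [folklore] -/
theorem solExt_congr {p q : Tor (fine n M) → Prop} [DecidablePred p] [DecidablePred q] (h : ∀ x, p x ↔ q x) (w : {x // q x} → ℂ) :
    solExt n M a' q w = solExt n M a' p (w ∘ (eqv h).symm) := by
  funext x
  unfold solExt
  rw [show DOm n M a' q = (DOm n M a' p).submatrix (eqv h) (eqv h) from toBlock_eq_submatrix h h _,
    Matrix.inv_submatrix_equiv, Matrix.submatrix_mulVec_equiv]
  by_cases hx : q x
  · have hp : p x := (h x).mpr hx
    simp only [SubtypeCompression.ext, dif_pos hx, dif_pos hp, Function.comp_apply]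
    rfl
  · have hp : ¬ p x := fun hp => hx ((h x).mp hp)
    simp only [SubtypeCompression.ext, dif_neg hx, dif_neg hp]

/-- `P_μ v = ∂_μᴴ(∂_μ v)`. [folklore] -/
theorem Pdir_mulVec_eq (c : ℂ) (μ : Fin d) (v : Tor (fine n M) → ℂ) :
    Pdir (fine n M) c μ *ᵥ v = (sdiff (fine n M) c μ)ᴴ *ᵥ (sdiff (fine n M) c μ *ᵥ v) := by
  rw [Pdir, Matrix.mulVec_mulVec]

/-- **FROM A SECOND-DIFFERENCE BUDGET TO THE TWO-LEVEL DEFECT ON A UNION OF BLOCKS.**  `N ≥ 1`, refinement factor `L`, `a′ > 0`, `S` a block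
set; if `‖∂_μᴴ∂_μ solExt_{LN}(blockReg_{LN} S) w‖² ≤ B‖w‖²` for every axis and datum, then
`‖(D′^{Ω′})⁻¹J − J(D^{Ω})⁻¹‖ ≤ 2d·√γ′⁻¹·√B / N` for `Ω = blockReg_N S`, `Ω′ = refineR N L Ω`. [folklore] -/
theorem opNorm_defect_blockReg_le_of_budget (N L : ℕ) [NeZero N] [NeZero L] (hN : 1 ≤ N) (ha' : 0 < a') (S : Tor M → Prop)
    [DecidablePred S] {B : ℝ} (hB : 0 ≤ B)
    (hbud : ∀ (μ : Fin d) (w : {x // blockReg (L * N) M S x} → ℂ),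
      nsq ((sdiff (fine (L * N) M) ((L * N : ℕ) : ℂ) μ)ᴴ *ᵥ (sdiff (fine (L * N) M) ((L * N : ℕ) : ℂ) μ
        *ᵥ solExt (L * N) M a' (blockReg (L * N) M S) w)) ≤ B * nsq w) :
    ‖(DOm (L * N) M a' (refineR N L M (blockReg N M S)))⁻¹ * JOm N L M (blockReg N M S)
        - JOm N L M (blockReg N M S) * (DOm N M a' (blockReg N M S))⁻¹‖
      ≤ 2 * d * Real.sqrt ((gammaPs d a')⁻¹) * Real.sqrt B / N := by
  have hγ := (gammaPs_pos (d := d) (a' := a')).1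
  have hNpos : 0 < (N : ℝ) := by exact_mod_cast hN
  have hiff : ∀ x, blockReg (L * N) M S x ↔ refineR N L M (blockReg N M S) x := fun x => (refineR_blockReg_iff N L M S x).symm
  refine opNorm_le_of_pairing _ (by positivity) fun w f => ?_
  rw [form_defect N L M a' (blockReg N M S) ha' w f]
  set v := solExt (L * N) M a' (refineR N L M (blockReg N M S)) w with hv
  set u := solExt N M a' (blockReg N M S) f with hu
  refine (norm_pairing_le N L M hN u v).trans ?_
  have hsum : ∀ μ : Fin d, Real.sqrt (nsq (sdiff (fine N M) (N : ℂ) μ *ᵥ u))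
        * Real.sqrt (nsq (Pdir (fine (L * N) M) ((L * N : ℕ) : ℂ) μ *ᵥ v))
      ≤ (Real.sqrt ((gammaPs d a')⁻¹) * Real.sqrt (nsq f)) * (Real.sqrt B * Real.sqrt (nsq w)) := by
    intro μ
    refine mul_le_mul ?_ ?_ (Real.sqrt_nonneg _) (by positivity)
    · rw [← Real.sqrt_mul (inv_nonneg.mpr hγ.le)]
      exact Real.sqrt_le_sqrt (nsq_sdiff_solExt_le N M a' _ ha' f μ)
    · rw [← Real.sqrt_mul hB, Pdir_mulVec_eq, hv, solExt_congr (L * N) M a' hiff w]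
      refine Real.sqrt_le_sqrt ((hbud μ _).trans (le_of_eq ?_))
      rw [nsq_comp_equiv]
  calc 2 / (N : ℝ) * ∑ μ : Fin d, Real.sqrt (nsq (sdiff (fine N M) (N : ℂ) μ *ᵥ u))
          * Real.sqrt (nsq (Pdir (fine (L * N) M) ((L * N : ℕ) : ℂ) μ *ᵥ v))
      ≤ 2 / (N : ℝ) * ∑ _μ : Fin d, (Real.sqrt ((gammaPs d a')⁻¹) * Real.sqrt (nsq f)) * (Real.sqrt B * Real.sqrt (nsq w)) :=
        mul_le_mul_of_nonneg_left (Finset.sum_le_sum fun μ _ => hsum μ) (by positivity)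
    _ = 2 * d * Real.sqrt ((gammaPs d a')⁻¹) * Real.sqrt B / N * Real.sqrt (nsq w) * Real.sqrt (nsq f) := by
        rw [Finset.sum_const, Finset.card_univ, Fintype.card_fin, nsmul_eq_mul]
        field_simp

end Summit.QuantumFields.BalabanUV.T4Continuum.DirichletBlockRegDefect

end
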